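import Summits.CriticalPhenomena.PercolationContinuityZ3.Theorems.Transplant.SkelFrmQuasiBParamsFramesF2
import Summits.CriticalPhenomena.PercolationContinuityZ3.Theorems.Transplant.SkelFrmBParamsFramesF2
import Summits.CriticalPhenomena.PercolationContinuityZ3.Theorems.Transplant.SkelFrmQuasiBParamsFaceOriginsXA
import Summits.CriticalPhenomena.PercolationContinuityZ3.Theorems.Transplant.SkelFrmBParamsFaceOriginsXA
import Summits.CriticalPhenomena.PercolationContinuityZ3.Theorems.Transplant.SkelFrmQuasiBParamsFaceFloorsClrXA
import Summits.CriticalPhenomena.PercolationContinuityZ3.Theorems.Transplant.SkelFrmBParamsFaceFloorsClrXA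
import Summits.CriticalPhenomena.PercolationContinuityZ3.Theorems.Transplant.PlanarSkeletonFrmQuasiDefs
import Summits.CriticalPhenomena.PercolationContinuityZ3.Theorems.Transplant.PlanarSkeletonFrmDefs
import Summits.CriticalPhenomena.PercolationContinuityZ3.Theorems.Transplant.SkelPhiStepIDataNS
import Summits.CriticalPhenomena.PercolationContinuityZ3.Theorems.Transplant.SkelFrmQuasi1SlotTypes
import HarnessLib
import Summits.CriticalPhenomena.PercolationContinuityZ3.Theorems.Transplant.SkelFrmBParamsFaceOriginsYA
/-!
# GEN-Q PORT (WAVE-Q table v0.8 section 2, row G190, U-level L19; captain R-6/R-7 2026-08-27: carrier token swap `PlanarSkeletonFrmFrom ↦ PlanarSkeletonFrmQuasi`)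
# of the tree module «Transplant/SkelFrmFromBParamsFaceOriginsYA» (sha256 a2d7f3a5576fd242…) onto the quasi-step carrier `PlanarSkeletonFrmQuasi` (p507026): «SkelFrmQuasiBParamsFaceOriginsYA»

HAND HUNK (L-FLOORMAP-1 ①⑥ / L-KitS-1 reader side; G017 «SkelFrmQuasiBChoiceNums», hp-8's KitSN): R'0×10 — the (S0) kit of record at window cost `KS.NQ Φ`.

ORIGINAL TITLE: (F) VALUE LAYER, N2 twin (hp-8 g42, 2026-08-23; F-DISCHARGE-MAP-N2 G18 y′-face LANDING ORIGINS `yLFs/d/t` and their Λ-sizes): `port_frm.py` text of N1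

builds on p205010 (kernel theorem, internal audit signed; external expert review pending) — nothing in this file uses p205010; NOTHING is claimed about any open node
((N3-b), the end state).  Lane `prim-bschramm`, seat `prim-bschramm-stmt` (gen 33; GEN-Q column pen; tool = captain gen-1 g4's port_genq.py R-14 --cone + p3-g30's T1 patch).  Helper file (`--supports stmt-CriticalPhenomena-4575 --as helper`).
PORT RULES (U-wave r1–r4 re-used, GEN-Q hunk classes of p3-g29 #6136): declaration order, names and proof texts are those of «SkelFrmFromBParamsFaceOriginsYA», byte-identical except
(i) the carrier token `PlanarSkeletonFrmFrom ↦ PlanarSkeletonFrmQuasi` in binders, `namespace`/`end` lines and qualified names (module names `SkelFrmFrom… ↦ SkelFrmQuasi…`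
in imports of already-ported rows); (ii) `Φ.step ↦ Φ.qstep` with the called Steps lemma replaced by its `…Q`/`_q` twin and the cost `Φ.M` threaded (none in this file unless
listed below); (iii) `Φ.cyl_connected ↦ Φ.cyl_reach` readers (none unless listed); (iv) graph-ball radii / window floors ×`Φ.M` (none unless listed).  Carrier-free
residents stay imported/exported from the original «SkelFrmBParamsFaceOriginsYA» exactly as in the FrmFrom port.  Docstrings and citations are the original's.

-/

noncomputable section

open scoped Classical

namespace Summit.CriticalPhenomena.PercolationContinuityZ3.Theorems.Transplant

namespace PlanarSkeletonFrmQuasi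

namespace NegB

open Literature.Probability.Percolation Literature.Probability.LatticeModels SimpleGraph
open SkelConc (Consts)
open Skelφ (shearUnit shearUnit_pos sgnz sgnz_cases)
open Skelφ.StepI (DataN)
open TwoAxis.Para (modulus)
open Neg

namespace KS

/-! ## §1 The generic origin `yLFof`: the exact `Λ₁` and the two sizes -/

section Generic

/-- **`Λ₁(yLFof σ σh c_lo c₀ b₁) = n_L·b₁ − σh·h_L·c₀ − (σh·h_L·v′ mod n_L)`**, `v′ = c_lo + n_L − c₀ + σσh·v_L` (`σh = ±1`). [folklore] -/
theorem Λ₁_yLFof (κ : Consts) {V : Type} [DecidableEq V] [Countable V] {G : SimpleGraph V} [G.LocallyFinite] (Φ : PlanarSkeletonFrmQuasi G) (t : V) (p : unitInterval) (D : Skelφ.StepI.DataNS V) (g : ℕ) (f : ℕ) {σh : ℤ} (hσh : σh = 1 ∨ σh = -1) (σ clo c₀ b₁ : ℤ) :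
    Λ₁of κ Φ t p D g f (yLFof κ Φ t p D g f σ σh clo c₀ b₁) =
      (nL κ Φ t p D g f : ℤ) * b₁ - σh * hL κ Φ t p D g f * c₀ -
        (σh * hL κ Φ t p D g f * (clo + nL κ Φ t p D g f - c₀ + σ * σh * vL κ Φ t p D g f)) % (nL κ Φ t p D g f : ℤ) := by
  have hσh2 : σh * σh = 1 := by rcases hσh with rfl | rfl <;> norm_num
  have hX := Int.emod_add_ediv_mul (σh * hL κ Φ t p D g f * (clo + nL κ Φ t p D g f - c₀ + σ * σh * vL κ Φ t p D g f)) (nL κ Φ t p D g f : ℤ)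
  unfold Λ₁of yLFof
  rw [Skelφ.pt_zero, Skelφ.pt_one]
  linear_combination hX + (σ * hL κ Φ t p D g f * vL κ Φ t p D g f) * hσh2

/-- `n_L·Λ₀(y) = m·y₀ − v_L·Λ₁(y)` (p1's `clr_modulus_mul_zero`, rearranged). [folklore] -/
theorem nL_mul_Λ₀of (κ : Consts) {V : Type} [DecidableEq V] [Countable V] {G : SimpleGraph V} [G.LocallyFinite] (Φ : PlanarSkeletonFrmQuasi G) (t : V) (p : unitInterval) (D : Skelφ.StepI.DataNS V) (g : ℕ) (f : ℕ) (y : Site 2) :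
    (nL κ Φ t p D g f : ℤ) * Λ₀of κ Φ t p D g f y =
      modulus (nL κ Φ t p D g f) (hL κ Φ t p D g f) (vL κ Φ t p D g f) (vβL κ Φ t p D g f) * y 0 - vL κ Φ t p D g f * Λ₁of κ Φ t p D g f y := by
  have := clr_modulus_mul_zero κ Φ t p D g f y
  linarith

end Generic

section GenericT

/-- **The two functional sizes of a y′-face origin `yLFof σ σh c_lo c₀ b₁`** at `g := gT` under the floor `16·S_F ≤ M_L`: `|Λ₀| ≤ 5m` and `|Λ₁| ≤ 2m` whenever
`|v′| ≤ 2n_L`, `|c₀| ≤ n_L + S_F + 5` and `2·|n_L b₁ − σh h_L c₀| ≤ n_Lℓ_L + 21·n_L·S_F + 220·n_L`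
(`16·S_F ≤ M_L < n_L, ℓ_L`, `|v_L| ≤ n_L`, `n_L(ℓ_L − 1) < m ≤ n_Lℓ_L`, `ℓ_L ≥ 44000`). [folklore] -/
theorem abs_Λ_yLFof_le (κ : Consts) {V : Type} [DecidableEq V] [Countable V] {G : SimpleGraph V} [G.LocallyFinite] (Φ : PlanarSkeletonFrmQuasi G) (t : V) (p : unitInterval) (D : Skelφ.StepI.DataNS V) (c : ℕ) (mk : ℕ) (gx : Neg.FSlot) (f : ℕ) (hN : EqNumL κ Φ t p D (gT mk gx κ Φ t p D) f) (hκ : (hL κ Φ t p D (gT mk gx κ Φ t p D) f).natAbs ≤ 10 * nL κ Φ t p D (gT mk gx κ Φ t p D) f)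
    (hS : 16 * SF κ Φ t p D c mk ≤ ML κ Φ t p D (gT mk gx κ Φ t p D)) (hMR0 : 22000 * (KS0.R'0N κ Φ (KS.NQ Φ) t p D mk + 2) ≤ ML κ Φ t p D (gT mk gx κ Φ t p D)) {σ σh : ℤ} (hσh : σh = 1 ∨ σh = -1) {clo c₀ b₁ : ℤ}
    (hv' : |clo + nL κ Φ t p D (gT mk gx κ Φ t p D) f - c₀ + σ * σh * vL κ Φ t p D (gT mk gx κ Φ t p D) f| ≤ 2 * (nL κ Φ t p D (gT mk gx κ Φ t p D) f : ℤ))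
    (hc₀ : |c₀| ≤ (nL κ Φ t p D (gT mk gx κ Φ t p D) f : ℤ) + ((SF κ Φ t p D c mk : ℕ) : ℤ) + 5)
    (hb : 2 * |(nL κ Φ t p D (gT mk gx κ Φ t p D) f : ℤ) * b₁ - σh * hL κ Φ t p D (gT mk gx κ Φ t p D) f * c₀| ≤
      (nL κ Φ t p D (gT mk gx κ Φ t p D) f : ℤ) * ℓL κ Φ t p D (gT mk gx κ Φ t p D) f +
        21 * ((nL κ Φ t p D (gT mk gx κ Φ t p D) f : ℤ) * ((SF κ Φ t p D c mk : ℕ) : ℤ)) + 220 * (nL κ Φ t p D (gT mk gx κ Φ t p D) f : ℤ)) :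
    |Λ₀of κ Φ t p D (gT mk gx κ Φ t p D) f (yLFof κ Φ t p D (gT mk gx κ Φ t p D) f σ σh clo c₀ b₁)| ≤
        5 * modulus (nL κ Φ t p D (gT mk gx κ Φ t p D) f) (hL κ Φ t p D (gT mk gx κ Φ t p D) f) (vL κ Φ t p D (gT mk gx κ Φ t p D) f) (vβL κ Φ t p D (gT mk gx κ Φ t p D) f) ∧
      |Λ₁of κ Φ t p D (gT mk gx κ Φ t p D) f (yLFof κ Φ t p D (gT mk gx κ Φ t p D) f σ σh clo c₀ b₁)| ≤
        2 * modulus (nL κ Φ t p D (gT mk gx κ Φ t p D) f) (hL κ Φ t p D (gT mk gx κ Φ t p D) f) (vL κ Φ t p D (gT mk gx κ Φ t p D) f) (vβL κ Φ t p D (gT mk gx κ Φ t p D) f) := by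
  obtain ⟨hn1, hℓ1⟩ := one_le_of_eqNumL κ Φ t p D _ f hN
  have hv : |vL κ Φ t p D (gT mk gx κ Φ t p D) f| ≤ nL κ Φ t p D (gT mk gx κ Φ t p D) f := hN.v_le
  have hMn := hN.n_le
  have hMℓ := hN.ℓ_le
  have hm := (Skelφ.NegPrm.modulus_vβOf hn1 (hL κ Φ t p D (gT mk gx κ Φ t p D) f) (ℓL κ Φ t p D (gT mk gx κ Φ t p D) f) (vL κ Φ t p D (gT mk gx κ Φ t p D) f))
  have e : vβL κ Φ t p D (gT mk gx κ Φ t p D) f =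
      Skelφ.NegPrm.vβOf (nL κ Φ t p D (gT mk gx κ Φ t p D) f) (hL κ Φ t p D (gT mk gx κ Φ t p D) f) (ℓL κ Φ t p D (gT mk gx κ Φ t p D) f) (vL κ Φ t p D (gT mk gx κ Φ t p D) f) := rfl
  rw [← e] at hm
  obtain ⟨hm1, hm2⟩ := hm
  have hκ' : |hL κ Φ t p D (gT mk gx κ Φ t p D) f| ≤ 10 * (nL κ Φ t p D (gT mk gx κ Φ t p D) f : ℤ) := by rw [← Int.natCast_natAbs]; exact_mod_cast hκ
  have hS16 : 16 * (((SF κ Φ t p D c mk : ℕ) : ℤ)) ≤ (ML κ Φ t p D (gT mk gx κ Φ t p D) : ℤ) := by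
    have h' : ((16 * SF κ Φ t p D c mk : ℕ) : ℤ) ≤ (ML κ Φ t p D (gT mk gx κ Φ t p D) : ℤ) := by exact_mod_cast hS
    simpa only [Nat.cast_mul, Nat.cast_ofNat] using h'
  have h22 : 22000 * ((KS0.R'0N κ Φ (KS.NQ Φ) t p D mk : ℤ) + 2) ≤ (ML κ Φ t p D (gT mk gx κ Φ t p D) : ℤ) := (show 22000 * ((KS0.R'0N κ Φ (KS.NQ Φ) t p D mk : ℤ) + 2) ≤ (ML κ Φ t p D (gT mk gx κ Φ t p D) : ℤ) by exact_mod_cast hMR0)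
  -- the exact Λ₁ and the identity `nΛ₀ = m y₀ − v Λ₁`
  have hΛ₁ := Λ₁_yLFof κ Φ t p D (gT mk gx κ Φ t p D) f hσh σ clo c₀ b₁
  have hΛ₀ := nL_mul_Λ₀of κ Φ t p D (gT mk gx κ Φ t p D) f (yLFof κ Φ t p D (gT mk gx κ Φ t p D) f σ σh clo c₀ b₁)
  have hy0 := (yLFof_eq κ Φ t p D (gT mk gx κ Φ t p D) f hσh σ clo c₀ b₁).1
  have hn0 : (0 : ℤ) < (nL κ Φ t p D (gT mk gx κ Φ t p D) f : ℤ) := by exact_mod_cast hn1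
  have hr0 : 0 ≤ (σh * hL κ Φ t p D (gT mk gx κ Φ t p D) f * (clo + nL κ Φ t p D (gT mk gx κ Φ t p D) f - c₀ + σ * σh * vL κ Φ t p D (gT mk gx κ Φ t p D) f)) %
      (nL κ Φ t p D (gT mk gx κ Φ t p D) f : ℤ) := Int.emod_nonneg _ hn0.ne'
  have hr1 : (σh * hL κ Φ t p D (gT mk gx κ Φ t p D) f * (clo + nL κ Φ t p D (gT mk gx κ Φ t p D) f - c₀ + σ * σh * vL κ Φ t p D (gT mk gx κ Φ t p D) f)) %
      (nL κ Φ t p D (gT mk gx κ Φ t p D) f : ℤ) < (nL κ Φ t p D (gT mk gx κ Φ t p D) f : ℤ) := Int.emod_lt_of_pos _ hn0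
  have hσh' : |σh| = 1 := by rcases hσh with h | h <;> simp [h]
  -- `|y₀| ≤ 3n + S + 5`
  have hy0abs : |yLFof κ Φ t p D (gT mk gx κ Φ t p D) f σ σh clo c₀ b₁ 0| ≤
      3 * (nL κ Φ t p D (gT mk gx κ Φ t p D) f : ℤ) + ((SF κ Φ t p D c mk : ℕ) : ℤ) + 5 := by
    rw [hy0, abs_mul, hσh', one_mul]
    exact (abs_add_le _ _).trans (by linarith)
  rw [hΛ₁]
  generalize (σh * hL κ Φ t p D (gT mk gx κ Φ t p D) f * (clo + nL κ Φ t p D (gT mk gx κ Φ t p D) f - c₀ + σ * σh * vL κ Φ t p D (gT mk gx κ Φ t p D) f)) %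
      (nL κ Φ t p D (gT mk gx κ Φ t p D) f : ℤ) = r at hr0 hr1 hΛ₁
  rw [hΛ₁] at hΛ₀
  generalize yLFof κ Φ t p D (gT mk gx κ Φ t p D) f σ σh clo c₀ b₁ 0 = y0 at hy0abs hΛ₀
  generalize Λ₀of κ Φ t p D (gT mk gx κ Φ t p D) f (yLFof κ Φ t p D (gT mk gx κ Φ t p D) f σ σh clo c₀ b₁) = L0 at hΛ₀
  generalize modulus (nL κ Φ t p D (gT mk gx κ Φ t p D) f) (hL κ Φ t p D (gT mk gx κ Φ t p D) f) (vL κ Φ t p D (gT mk gx κ Φ t p D) f) (vβL κ Φ t p D (gT mk gx κ Φ t p D) f) = m at hm1 hm2 hΛ₀ ⊢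
  have hS0 : (0 : ℤ) ≤ ((SF κ Φ t p D c mk : ℕ) : ℤ) := by positivity
  clear hy0 e hS hκ
  generalize ((SF κ Φ t p D c mk : ℕ) : ℤ) = S at hc₀ hb hS16 hy0abs hS0
  generalize (nL κ Φ t p D (gT mk gx κ Φ t p D) f : ℤ) = n at hn0 hv hMn hm1 hm2 hκ' hv' hc₀ hb hr1 hy0abs hΛ₀ ⊢
  generalize (ℓL κ Φ t p D (gT mk gx κ Φ t p D) f : ℤ) = ℓ at hMℓ hm1 hm2 hb ⊢
  generalize (ML κ Φ t p D (gT mk gx κ Φ t p D) : ℤ) = M at hMn hMℓ hS16 h22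
  generalize vL κ Φ t p D (gT mk gx κ Φ t p D) f = vα at hv hv' hΛ₀ ⊢
  generalize hL κ Φ t p D (gT mk gx κ Φ t p D) f = hh at hκ' hb hΛ₀ ⊢
  -- the key sizes
  have hR0 : (0 : ℤ) ≤ (KS0.R'0N κ Φ (KS.NQ Φ) t p D mk : ℤ) := by positivity
  have hn1' : (1 : ℤ) ≤ n := by linarith
  have hℓ44 : (44000 : ℤ) ≤ ℓ := by linarith
  have hm0 : 0 < m := by nlinarith
  have hnm : n * 40000 ≤ m := by nlinarith
  set T := n * b₁ - σh * hh * c₀ with hT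
  have hT1 : 2 * |T| ≤ n * ℓ + 21 * (n * S) + 220 * n := hb
  -- `|Λ₁| ≤ |T| + n ≤ 2m`
  have hL1 : |T - r| ≤ |T| + n := by
    have := abs_sub T r; have : |r| ≤ n := by rw [abs_of_nonneg hr0]; linarith
    linarith
  have q2 : n * (16 * S) ≤ n * (ℓ - 1) := mul_le_mul_of_nonneg_left (by linarith) (by linarith)
  constructor
  · -- `n|Λ₀| ≤ m|y₀| + |vα||Λ₁| ≤ m(3n + S + 5) + n(|T| + n) ≤ 5nm`
    have a1 : |n * L0| ≤ m * (3 * n + S + 5) + n * (|T| + n) := by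
      rw [hΛ₀]
      calc |m * y0 - vα * (T - r)| ≤ |m * y0| + |vα * (T - r)| := abs_sub _ _
        _ = m * |y0| + |vα| * |T - r| := by rw [abs_mul, abs_mul, abs_of_pos hm0]
        _ ≤ m * (3 * n + S + 5) + n * (|T| + n) := by
          have i1 := mul_le_mul_of_nonneg_left hy0abs hm0.le
          have i2 : |vα| * |T - r| ≤ n * (|T| + n) := mul_le_mul hv hL1 (abs_nonneg _) (by linarith)
          linarith
    have a2 : m * (16 * S) ≤ m * (n - 1) := mul_le_mul_of_nonneg_left (by linarith) hm0.le
    have a3 : n * (2 * |T|) ≤ n * (n * ℓ + 21 * (n * S) + 220 * n) := mul_le_mul_of_nonneg_left hT1 (by linarith)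
    have a4 : n * (n * ℓ) ≤ n * (m + n) := mul_le_mul_of_nonneg_left (by linarith) (by linarith)
    have a5 : n * (n * (16 * S)) ≤ n * (n * (ℓ - 1)) := mul_le_mul_of_nonneg_left q2 (by linarith)
    have a6 : n * (n * 40000) ≤ n * m := mul_le_mul_of_nonneg_left hnm (by linarith)
    have a7 : m * 44001 ≤ n * m := by nlinarith
    have e2 : |n * L0| = n * |L0| := by rw [abs_mul, abs_of_pos hn0]
    rw [e2] at a1
    have key' : n * |L0| ≤ n * (5 * m) := by linarith [a1, a2, a3, a4, a5, a6, a7, abs_nonneg T, hS0]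
    exact le_of_mul_le_mul_left key' hn0
  · have q3 : n * 44000 ≤ n * ℓ := mul_le_mul_of_nonneg_left hℓ44 hn0.le
    calc |T - r| ≤ |T| + n := hL1
      _ ≤ 2 * m := by linarith [hT1, q2, q3, hm1, hS0, abs_nonneg T]

end GenericT

/-! ## §2 The three origins of record -/

section Cases

/-- `yLFs σ σh` is the generic origin at `c_lo := n_L + nBF − RA′`, `c₀ := n_L + nBF`, `b₁ := σh(h_L + hBF) + ⌊(ℓ_L + ℓBF)/2⌋`. [folklore] -/
theorem yLFs_eq_yLFof (κ : Consts) {V : Type} [DecidableEq V] [Countable V] {G : SimpleGraph V} [G.LocallyFinite] (Φ : PlanarSkeletonFrmQuasi G) (t : V) (p : unitInterval) (D : Skelφ.StepI.DataNS V) (c : ℕ) (mk : ℕ) (f : ℕ) (g : ℕ) (σ σh : ℤ) :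
    yLFs κ Φ t p D c mk g f σ σh = yLFof κ Φ t p D g f σ σh ((nL κ Φ t p D g f : ℤ) + nBF κ Φ t p D c mk - KS0.R'0N κ Φ (KS.NQ Φ) t p D mk)
      ((nL κ Φ t p D g f : ℤ) + nBF κ Φ t p D c mk) (σh * (hL κ Φ t p D g f + hBF κ Φ t p D c mk) + ((ℓL κ Φ t p D g f : ℤ) + ℓBF κ Φ t p D c mk) / 2) := by
  unfold yLFs yLFof
  congr 1
  ring

/-- **`|Λ₀(yLFs)| ≤ 5m`, `|Λ₁(yLFs)| ≤ 2m`** (case `o_b = o_L`, both hop sides; floor `16·S_F ≤ M_L`). [folklore] -/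
theorem Λ_yLFs (κ : Consts) {V : Type} [DecidableEq V] [Countable V] {G : SimpleGraph V} [G.LocallyFinite] (Φ : PlanarSkeletonFrmQuasi G) (t : V) (p : unitInterval) (D : Skelφ.StepI.DataNS V) (c : ℕ) (mk : ℕ) (gx : Neg.FSlot) (f : ℕ) (hN : EqNumL κ Φ t p D (gT mk gx κ Φ t p D) f) (hκ : (hL κ Φ t p D (gT mk gx κ Φ t p D) f).natAbs ≤ 10 * nL κ Φ t p D (gT mk gx κ Φ t p D) f)
    (hS : 16 * SF κ Φ t p D c mk ≤ ML κ Φ t p D (gT mk gx κ Φ t p D)) (hMR0 : 22000 * (KS0.R'0N κ Φ (KS.NQ Φ) t p D mk + 2) ≤ ML κ Φ t p D (gT mk gx κ Φ t p D)) {σ σh : ℤ} (hσ : σ = 1 ∨ σ = -1) (hσh : σh = 1 ∨ σh = -1) :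
    |Λ₀of κ Φ t p D (gT mk gx κ Φ t p D) f (yLFs κ Φ t p D c mk (gT mk gx κ Φ t p D) f σ σh)| ≤
        5 * modulus (nL κ Φ t p D (gT mk gx κ Φ t p D) f) (hL κ Φ t p D (gT mk gx κ Φ t p D) f) (vL κ Φ t p D (gT mk gx κ Φ t p D) f) (vβL κ Φ t p D (gT mk gx κ Φ t p D) f) ∧
      |Λ₁of κ Φ t p D (gT mk gx κ Φ t p D) f (yLFs κ Φ t p D c mk (gT mk gx κ Φ t p D) f σ σh)| ≤
        2 * modulus (nL κ Φ t p D (gT mk gx κ Φ t p D) f) (hL κ Φ t p D (gT mk gx κ Φ t p D) f) (vL κ Φ t p D (gT mk gx κ Φ t p D) f) (vβL κ Φ t p D (gT mk gx κ Φ t p D) f) := by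
  rw [yLFs_eq_yLFof]
  obtain ⟨hn1, hℓ1⟩ := one_le_of_eqNumL κ Φ t p D _ f hN
  have hv : |vL κ Φ t p D (gT mk gx κ Φ t p D) f| ≤ nL κ Φ t p D (gT mk gx κ Φ t p D) f := hN.v_le
  have hκ' : |hL κ Φ t p D (gT mk gx κ Φ t p D) f| ≤ 10 * (nL κ Φ t p D (gT mk gx κ Φ t p D) f : ℤ) := by rw [← Int.natCast_natAbs]; exact_mod_cast hκ
  have hSe := SF_int κ Φ t p D c mk
  have hRn : (KS0.R'0N κ Φ (KS.NQ Φ) t p D mk : ℤ) ≤ nL κ Φ t p D (gT mk gx κ Φ t p D) f := by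
    have h22 := (show 22000 * ((KS0.R'0N κ Φ (KS.NQ Φ) t p D mk : ℤ) + 2) ≤ (ML κ Φ t p D (gT mk gx κ Φ t p D) : ℤ) by exact_mod_cast hMR0); have := hN.n_le; have hR0 : (0 : ℤ) ≤ (KS0.R'0N κ Φ (KS.NQ Φ) t p D mk : ℤ) := by positivity
    linarith
  have hR0 : (0 : ℤ) ≤ (KS0.R'0N κ Φ (KS.NQ Φ) t p D mk : ℤ) := by positivity
  have hnB0 : (0 : ℤ) ≤ (nBF κ Φ t p D c mk : ℤ) := by positivity
  have hℓB0 : (0 : ℤ) ≤ (ℓBF κ Φ t p D c mk : ℤ) := by positivity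
  have hσ2 : |σ * σh| ≤ 1 := by rcases hσ with rfl | rfl <;> rcases hσh with rfl | rfl <;> norm_num
  refine abs_Λ_yLFof_le κ Φ t p D c mk gx f hN hκ hS hMR0 hσh ?_ ?_ ?_
  · -- `v′ = n − RA′ + σσh v ∈ [−RA′ − n, 2n]`
    have h1 : |σ * σh * vL κ Φ t p D (gT mk gx κ Φ t p D) f| ≤ nL κ Φ t p D (gT mk gx κ Φ t p D) f := by
      rw [abs_mul]; nlinarith [abs_nonneg (vL κ Φ t p D (gT mk gx κ Φ t p D) f), abs_nonneg (σ * σh)]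
    rw [abs_le] at h1 ⊢; constructor <;> linarith [h1.1, h1.2]
  · rw [abs_le]; constructor <;> linarith [abs_nonneg (hBF κ Φ t p D c mk)]
  · -- `n b₁ − σh h c₀ = n σh hBF + n⌊(ℓ+ℓBF)/2⌋ − σh h nBF`
    have hσh2 : σh * σh = 1 := by rcases hσh with rfl | rfl <;> norm_num
    have hσh' : |σh| = 1 := by rcases hσh with h | h <;> simp [h]
    obtain ⟨f1, f2⟩ := PlanarSkeletonNeg.NegB.RootArith.floor_sandwich (x := (ℓL κ Φ t p D (gT mk gx κ Φ t p D) f : ℤ) + ℓBF κ Φ t p D c mk) (d := 2) (by norm_num)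
    set mh := ((ℓL κ Φ t p D (gT mk gx κ Φ t p D) f : ℤ) + ℓBF κ Φ t p D c mk) / 2
    have e1 : (nL κ Φ t p D (gT mk gx κ Φ t p D) f : ℤ) * (σh * (hL κ Φ t p D (gT mk gx κ Φ t p D) f + hBF κ Φ t p D c mk) + mh) -
        σh * hL κ Φ t p D (gT mk gx κ Φ t p D) f * ((nL κ Φ t p D (gT mk gx κ Φ t p D) f : ℤ) + nBF κ Φ t p D c mk) =
        σh * ((nL κ Φ t p D (gT mk gx κ Φ t p D) f : ℤ) * hBF κ Φ t p D c mk) + (nL κ Φ t p D (gT mk gx κ Φ t p D) f : ℤ) * mh -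
          σh * (hL κ Φ t p D (gT mk gx κ Φ t p D) f * nBF κ Φ t p D c mk) := by ring
    rw [e1]
    have hn0 : (0 : ℤ) ≤ (nL κ Φ t p D (gT mk gx κ Φ t p D) f : ℤ) := by positivity
    have t1 : |σh * ((nL κ Φ t p D (gT mk gx κ Φ t p D) f : ℤ) * hBF κ Φ t p D c mk)| ≤ (nL κ Φ t p D (gT mk gx κ Φ t p D) f : ℤ) * |hBF κ Φ t p D c mk| := by
      rw [abs_mul, hσh', one_mul, abs_mul, abs_of_nonneg hn0]
    have t2 : |(nL κ Φ t p D (gT mk gx κ Φ t p D) f : ℤ) * mh| ≤ (nL κ Φ t p D (gT mk gx κ Φ t p D) f : ℤ) * mh := by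
      rw [abs_mul, abs_of_nonneg hn0, abs_of_nonneg (by omega)]
    have t3 : |σh * (hL κ Φ t p D (gT mk gx κ Φ t p D) f * nBF κ Φ t p D c mk)| ≤ 10 * (nL κ Φ t p D (gT mk gx κ Φ t p D) f : ℤ) * nBF κ Φ t p D c mk := by
      rw [abs_mul, hσh', one_mul, abs_mul, abs_of_nonneg hnB0]; exact mul_le_mul_of_nonneg_right hκ' hnB0
    have t4 := abs_sub (σh * ((nL κ Φ t p D (gT mk gx κ Φ t p D) f : ℤ) * hBF κ Φ t p D c mk) + (nL κ Φ t p D (gT mk gx κ Φ t p D) f : ℤ) * mh)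
      (σh * (hL κ Φ t p D (gT mk gx κ Φ t p D) f * nBF κ Φ t p D c mk))
    have t5 := abs_add_le (σh * ((nL κ Φ t p D (gT mk gx κ Φ t p D) f : ℤ) * hBF κ Φ t p D c mk)) ((nL κ Φ t p D (gT mk gx κ Φ t p D) f : ℤ) * mh)
    rw [hSe]
    have p1 : (nL κ Φ t p D (gT mk gx κ Φ t p D) f : ℤ) * (2 * mh) ≤ (nL κ Φ t p D (gT mk gx κ Φ t p D) f : ℤ) * ((ℓL κ Φ t p D (gT mk gx κ Φ t p D) f : ℤ) + ℓBF κ Φ t p D c mk) :=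
      mul_le_mul_of_nonneg_left (by linarith) hn0
    nlinarith [t1, t2, t3, t4, t5, p1, mul_nonneg hn0 (abs_nonneg (hBF κ Φ t p D c mk)), mul_nonneg hn0 hnB0, mul_nonneg hn0 hℓB0]

-- GEN-Q (R-2, captain 2026-08-27): `PlanarSkeletonFrmFrom.NegB.KS.Λ_yLFd` is not in the used cone of the node top — not ported.

-- GEN-Q (R-2, captain 2026-08-27): `PlanarSkeletonFrmFrom.NegB.KS.Λ_yLFt` is not in the used cone of the node top — not ported.

end Cases

end KS

end NegB

end PlanarSkeletonFrmQuasi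

end Summit.CriticalPhenomena.PercolationContinuityZ3.Theorems.Transplant

end
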